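import Mathlib
import Summits.NavierStokesRegularity.NavierStokesRegularity.Theorems.TypeIQuarterGateScarEnvelopeTypeIZoomDictionaryDefs
import Summits.NavierStokesRegularity.NavierStokesRegularity.Theorems.TypeIQuarterGateScarEnvelopeTypeIFatKill
import Summits.NavierStokesRegularity.NavierStokesRegularity.Theorems.TypeIQuarterGateScarEnvelopeTypeIBudgetViolators
import Summits.NavierStokesRegularity.NavierStokesRegularity.Theorems.TypeIQuarterGateScarEnvelopeTypeIOfNoTwinScarObject
import Summits.NavierStokesRegularity.NavierStokesRegularity.Theorems.TypeIQuarterGateQuarterLawTypeIGlue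
import Summits.NavierStokesRegularity.NavierStokesRegularity.Theorems.TypeIQuarterGateEnvelopeQuarterLaw
import Summits.NavierStokesRegularity.NavierStokesRegularity.Theorems.TypeIQuarterGateScarEnvelopeTypeINearOneRateDss
import Literature.Analysis.FluidPDE.AncientAxisymmetricTypeILiouville
import Summits.NavierStokesRegularity.NavierStokesRegularity.Theorems.TypeIQuarterGateScarEnvelopeTypeIZoomDictionaryLemmas
import Summits.NavierStokesRegularity.NavierStokesRegularity.Theorems.TypeIQuarterGateScarEnvelopeTypeIZoomDictionaryPersistence
import Summits.NavierStokesRegularity.NavierStokesRegularity.Theorems.TypeIQuarterGateScarEnvelopeTypeISatelliteTowerDefs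
import Summits.NavierStokesRegularity.NavierStokesRegularity.Theorems.TypeIQuarterGateScarEnvelopeTypeISatelliteTowerObjects

/-!
# Part K4, K7, K8: tower statements; T2 persistence; T1 closure in the engine class

Part K of the plate: K4 the typed tower statements, K7 `TowerPersists` holds (satellites persist down the tower, A–B Prop. 2.3 at the vertex), K8 T1 in the engine class (tangent flows of A–B objects are A–B objects, same rate).

PROVENANCE: declaration texts VERBATIM from the HOME plates of the instrument seat nsreg-p3 (g24/g25, cell
`pub/ns-regularity-ideate`): `round-31/Tangent31prep.lean` v5 (sha16 `e5b8668e3a090216`; = ROUND-30 plate v10 + Part K) and,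
for Part L, `round-32/Tangent32prep.lean` v6 (sha16 `6123f27718636121`);
the author cannot write under `Theorems/` (`perm.theorems-prover-only`); landed by the
LEAD-lineage prover ns-sz-p1 g5 on director-ns DIRECTOR-NS #218 (2), split into ≤ 400-line modules (the
plate's `def`s gathered in `TypeIQuarterGateScarEnvelopeTypeIZoomDictionaryDefs`), namespace
`Summit.NavierStokesRegularity.NavierStokesRegularity.Cruxes.ScarEnvelopeTypeI.ZoomDictionary` (the plate's `NsregP3.R30P`), `E3` spelled out, one-line docstrings
added where the plate had none.  `--supports stmt-NavierStokesRegularity-23843 --as helper`.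

HONEST FRAMING: dictionary / census TOOLING for the crux `TypeIQuarterGate.ScarEnvelopeTypeI` (item 23843):
equivalences and normal forms, kernel-checked; NO open statement is proved — 23843, its parent
`QuarterLawTypeI` (23726), the route and Navier–Stokes regularity are OPEN; hard core evaded: none.
-/

-- the summit-side namespace repeats a component by design (single-conjunct summit, D-0017)
set_option linter.dupNamespace false

open MeasureTheory Set Metric Filter Topology
open scoped ENNReal

namespace Summit.NavierStokesRegularity.NavierStokesRegularity.Cruxes.ScarEnvelopeTypeI.ZoomDictionary

variable {u : ℝ → (EuclideanSpace ℝ (Fin 3)) → (EuclideanSpace ℝ (Fin 3))} {a : (EuclideanSpace ℝ (Fin 3))} {ν T : ℝ}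

section Tower

open Literature.Analysis.FluidPDE
variable {U : ℝ → (EuclideanSpace ℝ (Fin 3)) → (EuclideanSpace ℝ (Fin 3))} {P : ℝ → (EuclideanSpace ℝ (Fin 3)) → ℝ} {y' : (EuclideanSpace ℝ (Fin 3))} {ν : ℝ}

/-! ### K4. The tower statements (typed targets for ROUND-31; not proved here) -/

/-- (T3) **The dichotomy at a satellite**, kernel form of the census step: for a tower object `U`
and a satellite `y'`, either `y'` is tame, or some tangent flow of `U` at `y'` has a satellite in
the unit ball.  Immediate from `towerDictionary_inBall`. -/
theorem tame_or_descends {M : ℝ} (h : TowerObj M U P) {y' : (EuclideanSpace ℝ (Fin 3))}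
    (hy : y' ∈ satellites U) :
    TameSatellite U y' ∨
      ∃ (L : ℕ → ℝ) (Ū : ℝ → (EuclideanSpace ℝ (Fin 3)) → (EuclideanSpace ℝ (Fin 3))), TangentU U P y' 0 L Ū ∧
        ∃ y'' ∈ satellites Ū, ‖y''‖ < 1 := by
  by_cases hb : BudgetAt 1 0 U y'
  · exact Or.inl ⟨hy, hb⟩
  · right
    rw [towerDictionary_inBall h y'] at hb
    push Not at hb
    obtain ⟨L, Ū, hT, y'', hy0, hy1, hreg⟩ := hb
    exact ⟨L, Ū, hT, y'', ⟨hy0, hreg⟩, hy1⟩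

/-! ### K7. T2 holds: satellites persist down the tower (A–B Prop. 2.3 read at the vertex) -/

/-- Every zoom of a pair in A–B's class on all balls is in the class on the unit ball. -/
theorem inBall_one_zoom
    (h : ∀ a : ℝ, 0 < a → IsSuitableWeakSolutionInBall a (0 : ℝ × (EuclideanSpace ℝ (Fin 3))) U P) (y' : (EuclideanSpace ℝ (Fin 3))) {L : ℝ}
    (hL : 0 < L) :
    IsSuitableWeakSolutionInBall 1 (0 : ℝ × (EuclideanSpace ℝ (Fin 3))) (zoom U y' 0 L) (zoomP P y' 0 L) := by
  have hsub : parabolicCylinder L ((0 : ℝ), y') ⊆ parabolicCylinder (‖y'‖ + L) (0 : ℝ × (EuclideanSpace ℝ (Fin 3))) :=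
    parabolicCylinder_subset_zero
      (pow_le_pow_left₀ hL.le (by linarith [norm_nonneg y']) 2) le_rfl
  have h1 : IsSuitableWeakSolutionInBall L ((0 : ℝ), y') U P :=
    (h (‖y'‖ + L) (by positivity)).of_subset_zero hL hsub
  rw [zoom_eq_smul_stPull, zoomP_eq_smul_stPull]
  exact h1.zoom hL

/-- Regularity transports back along a zoom centred at `(0, y')`: if `zoom U y' 0 c` is regular at
the origin then `U` is regular at `(0, y')`. -/
theorem regPt_of_regPt_zoom_zero {c : ℝ} (hc0 : 0 < c) {U : ℝ → (EuclideanSpace ℝ (Fin 3)) → (EuclideanSpace ℝ (Fin 3))} {y' : (EuclideanSpace ℝ (Fin 3))}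
    (h : RegPt (zoom U y' 0 c) 0) : RegPt U y' := by
  obtain ⟨r, hr, M, hM⟩ := h
  refine ⟨c * r, mul_pos hc0 hr, c⁻¹ * M, ?_⟩
  have hpre : stAffine (c ^ 2) c 0 y' ⁻¹' parabolicCylinder (c * r) ((0 : ℝ), y') =
      parabolicCylinder r ((0 : ℝ), (0 : (EuclideanSpace ℝ (Fin 3)))) := by
    have h1 := LocalTypeIScaling.stAffine_preimage_parabolicCylinder hc0 (0 : ℝ) y' r
      ((0 : ℝ), (0 : (EuclideanSpace ℝ (Fin 3))))
    have e : stAffine (c ^ 2) c 0 y' ((0 : ℝ), (0 : (EuclideanSpace ℝ (Fin 3)))) = ((0 : ℝ), y') := by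
      rw [stAffine_apply, mul_zero, add_zero, smul_zero, add_zero]
    rwa [e] at h1
  apply ae_restrict_of_ae_restrict_preimage_stAffine (pow_pos hc0 2) hc0 (0 : ℝ) y'
  rw [hpre]
  filter_upwards [hM] with z hz
  obtain ⟨s, y⟩ := z
  have hz' : ‖c • U (0 + c ^ 2 * s) (y' + c • y)‖ ≤ M := hz
  rw [norm_smul, Real.norm_of_nonneg hc0.le] at hz'
  rw [stAffine_apply]
  dsimp only
  rw [le_inv_mul_iff₀ hc0]
  exact hz'

/-- **(T2) holds**: a satellite of a tower object persists as the axis singularity of every tangent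
flow there — Part F's `persistenceU_holds` (A–B Prop. 2.3 contrapositive) read at the vertex, the
uniform bound from `ZoomsBddU`, un-zoomed by `regPt_of_regPt_zoom_zero`. -/
theorem towerPersists_holds (M : ℝ) : TowerPersists M := by
  intro U P hT y' hy L Ū hTan hreg
  obtain ⟨hL, hL0, pbar, hR⟩ := hTan
  have hIB := hT.1
  obtain ⟨C, hCt, L₁, hL₁, hBdd⟩ := (zoomsBddU_tshift_iff).1 (hT.inputs y').2.2.2
  -- shift the scales below `L₁`
  obtain ⟨k₀, hk₀⟩ := Filter.eventually_atTop.1 (hL0.eventually (Iic_mem_nhds hL₁))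
  set L' : ℕ → ℝ := fun k => L (k + k₀) with hL'def
  have hL' : ∀ k, 0 < L' k := fun k => hL _
  have hL'1 : ∀ k, L' k ≤ L₁ := fun k => hk₀ _ (Nat.le_add_left k₀ k)
  set v : ℕ → ℝ → (EuclideanSpace ℝ (Fin 3)) → (EuclideanSpace ℝ (Fin 3)) := fun k => zoom U y' 0 (L' k) with hvdef
  set q : ℕ → ℝ → (EuclideanSpace ℝ (Fin 3)) → ℝ := fun k => zoomP P y' 0 (L' k) with hqdef
  have hρ : (0 : ℝ) < 1 / 2 := by norm_num
  obtain ⟨h2, -, h4, h5⟩ := hR (1 / 2) ⟨hρ, by norm_num⟩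
  have hsub : parabolicCylinder (1 / 2) (0 : ℝ × (EuclideanSpace ℝ (Fin 3))) ⊆ parabolicCylinder 1 (0 : ℝ × (EuclideanSpace ℝ (Fin 3))) :=
    parabolicCylinder_mono hρ.le (by norm_num) _
  have h1 : ∀ k, IsSuitableWeakSolutionInBall (1 / 2) (0 : ℝ × (EuclideanSpace ℝ (Fin 3))) (v k) (q k) := fun k =>
    (inBall_one_zoom hIB y' (hL' k)).of_subset_zero hρ hsub
  have hμ : volume.restrict (parabolicCylinder (1 / 2) (0 : ℝ × (EuclideanSpace ℝ (Fin 3)))) ≤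
      volume.restrict (parabolicCylinder 1 (0 : ℝ × (EuclideanSpace ℝ (Fin 3)))) := Measure.restrict_mono hsub le_rfl
  have h3 : (⨆ k, eLpNorm (Function.uncurry (v k)) 3
        (volume.restrict (parabolicCylinder (1 / 2) (0 : ℝ × (EuclideanSpace ℝ (Fin 3))))) +
      eLpNorm (Function.uncurry (q k)) (3 / 2)
        (volume.restrict (parabolicCylinder (1 / 2) (0 : ℝ × (EuclideanSpace ℝ (Fin 3)))))) < ⊤ := by
    refine lt_of_le_of_lt (iSup_le fun k => ?_) hCt
    exact (add_le_add (eLpNorm_mono_measure _ hμ) (eLpNorm_mono_measure _ hμ)).trans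
      (hBdd (L' k) (hL' k) (hL'1 k))
  obtain ⟨r, hr, M', hev⟩ := persistenceU_holds v q Ū pbar 0 (1 / 2) hρ h1 h2 h3
    (h4.comp (tendsto_add_atTop_nat k₀)) (fun g hg => (h5 g hg).comp (tendsto_add_atTop_nat k₀))
    hreg
  obtain ⟨k, hk⟩ := hev.exists
  exact hy.2 (regPt_of_regPt_zoom_zero (hL' k) ⟨r, hr, M', hk⟩)

/-! ### K8. T1 holds in the engine class: tangent flows of A–B objects are A–B objects

`abTower_closed`: for `(U, P, H)` in the engine class and a tangent flow `Ū` of `U` at a final-time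
point `(0, y')` (Part D's `TangentU`, any null sequence of scales), there is an A–B object
`(U', P', H')` with `Ū = U'` a.e. on every `Q_R(0)`, `R < 1`.  Proof = the tree's compactness
theorem WITH the class on all balls (`SliceBudget.local_typeI_compactness_twin_inBall`) applied to
the zooms (in the class on every `Q(0, 2ᵐ)` because `U` is, `𝐈` scale-invariant), the rate passed
to the limit a.e., and the two representative theorems (`exists_repr_hasTypeITimeDecay`,
`exists_oseenMild_repr_of_typeIBound_lt_top`) + KNSS (`isTypeIAncientMild_of_continuous_oseenMild_rate`);
the identification with `Ū` is uniqueness of `L³` limits. -/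

/-- An a.e.-convergent subsequence from `L³` convergence. -/
theorem exists_subseq_tendsto_ae₃ {Q₀ : Set (ℝ × (EuclideanSpace ℝ (Fin 3)))} {v : ℕ → ℝ → (EuclideanSpace ℝ (Fin 3)) → (EuclideanSpace ℝ (Fin 3))} {W : ℝ → (EuclideanSpace ℝ (Fin 3)) → (EuclideanSpace ℝ (Fin 3))}
    (hv : ∀ k, AEStronglyMeasurable (Function.uncurry (v k)) (volume.restrict Q₀))
    (hW : AEStronglyMeasurable (Function.uncurry W) (volume.restrict Q₀))
    (hconv : Tendsto (fun k => eLpNorm (Function.uncurry (v k) - Function.uncurry W) 3 (volume.restrict Q₀))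
      atTop (𝓝 0)) :
    ∃ φ : ℕ → ℕ, StrictMono φ ∧ ∀ᵐ w ∂(volume.restrict Q₀),
      Tendsto (fun i => Function.uncurry (v (φ i)) w) atTop (𝓝 (Function.uncurry W w)) :=
  (tendstoInMeasure_of_tendsto_eLpNorm (by norm_num) hv hW hconv).exists_seq_tendsto_ae

/-- Every point of the open backward slab lies in some `Q(0, 2ᵐ)`. -/
theorem exists_mem_parabolicCylinder_two_pow₃ {t : ℝ} (ht : t < 0) (x : (EuclideanSpace ℝ (Fin 3))) :
    ∃ m : ℕ, ((t, x) : ℝ × (EuclideanSpace ℝ (Fin 3))) ∈ parabolicCylinder ((2 : ℝ) ^ m) (0 : ℝ × (EuclideanSpace ℝ (Fin 3))) := by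
  obtain ⟨m, hm⟩ := pow_unbounded_of_one_lt (max (-t) ‖x‖ + 1) (by norm_num : (1 : ℝ) < 2)
  refine ⟨m, ?_⟩
  have h2 : -t < (2 : ℝ) ^ m := by linarith [le_max_left (-t) ‖x‖]
  have h3 : ‖x‖ < (2 : ℝ) ^ m := by linarith [le_max_right (-t) ‖x‖]
  have h1 : (1 : ℝ) ≤ (2 : ℝ) ^ m := one_le_pow₀ (by norm_num)
  rw [mem_parabolicCylinder]
  simp only [Prod.fst_zero, Prod.snd_zero, zero_sub, dist_zero_right]
  refine ⟨⟨?_, ht⟩, h3⟩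
  nlinarith

/-- `L³` limits are a.e. unique. -/
theorem ae_eq_of_tendsto_eLpNorm_three {μ : Measure (ℝ × (EuclideanSpace ℝ (Fin 3)))} {f : ℕ → ℝ × (EuclideanSpace ℝ (Fin 3)) → (EuclideanSpace ℝ (Fin 3))}
    {g g' : ℝ × (EuclideanSpace ℝ (Fin 3)) → (EuclideanSpace ℝ (Fin 3))} (hf : ∀ k, AEStronglyMeasurable (f k) μ)
    (hg : AEStronglyMeasurable g μ) (hg' : AEStronglyMeasurable g' μ)
    (h1 : Tendsto (fun k => eLpNorm (f k - g) 3 μ) atTop (𝓝 0))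
    (h2 : Tendsto (fun k => eLpNorm (f k - g') 3 μ) atTop (𝓝 0)) : g =ᵐ[μ] g' := by
  have hle : ∀ k, eLpNorm (g - g') 3 μ ≤ eLpNorm (f k - g) 3 μ + eLpNorm (f k - g') 3 μ := by
    intro k
    have e : g - g' = (f k - g') - (f k - g) := by abel
    rw [e]
    calc eLpNorm ((f k - g') - (f k - g)) 3 μ ≤ eLpNorm (f k - g') 3 μ + eLpNorm (f k - g) 3 μ :=
          eLpNorm_sub_le ((hf k).sub hg') ((hf k).sub hg) (by norm_num)
      _ = eLpNorm (f k - g) 3 μ + eLpNorm (f k - g') 3 μ := add_comm _ _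
  have h0 : eLpNorm (g - g') 3 μ = 0 := by
    refine le_antisymm ?_ (by simp)
    have ht : Tendsto (fun k => eLpNorm (f k - g) 3 μ + eLpNorm (f k - g') 3 μ) atTop (𝓝 0) := by
      simpa using h1.add h2
    exact ge_of_tendsto' ht hle
  have h := (eLpNorm_eq_zero_iff (hg.sub hg') (by norm_num)).1 h0
  filter_upwards [h] with w hw
  exact sub_eq_zero.1 hw

/-- **(T1) in the engine class.** Tangent flows of A–B objects at final-time points are (a.e. on
every `Q_R(0)`, `R < 1`) A–B objects with the same rate constant. -/
theorem abTower_closed {M : ℝ} {H : ℝ → (EuclideanSpace ℝ (Fin 3)) → (EuclideanSpace ℝ (Fin 3)) →L[ℝ] (EuclideanSpace ℝ (Fin 3))} (h : ABTower M U P H) {y' : (EuclideanSpace ℝ (Fin 3))}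
    {L : ℕ → ℝ} {Ū : ℝ → (EuclideanSpace ℝ (Fin 3)) → (EuclideanSpace ℝ (Fin 3))} (ht : TangentU U P y' 0 L Ū) :
    ∃ (U' : ℝ → (EuclideanSpace ℝ (Fin 3)) → (EuclideanSpace ℝ (Fin 3))) (P' : ℝ → (EuclideanSpace ℝ (Fin 3)) → ℝ) (H' : ℝ → (EuclideanSpace ℝ (Fin 3)) → (EuclideanSpace ℝ (Fin 3)) →L[ℝ] (EuclideanSpace ℝ (Fin 3))), ABTower M U' P' H' ∧
      ∀ R ∈ Ioo (0 : ℝ) 1, ∀ᵐ z ∂(volume.restrict (parabolicCylinder R (0 : ℝ × (EuclideanSpace ℝ (Fin 3))))),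
        Ū z.1 z.2 = U' z.1 z.2 := by
  obtain ⟨hmild, hIB, hH, hI⟩ := h
  obtain ⟨hL, hL0, pbar, hTR⟩ := ht
  have hdec : HasTypeITimeDecay M U := hmild.2.2.2
  have hM : 0 ≤ M := by
    have h := hdec (-1) (by norm_num) 0
    rw [neg_neg, Real.sqrt_one, div_one] at h
    exact (norm_nonneg _).trans h
  have hcc_pos : ∀ m : ℕ, (0 : ℝ) < (2 : ℝ) ^ m := fun m => by positivity
  set I₀ : ℝ≥0∞ := typeIBound (Iio (0 : ℝ) ×ˢ univ) U P H with hI₀def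
  set z₀ : ℝ × (EuclideanSpace ℝ (Fin 3)) := ((0 : ℝ), y') with hz₀def
  have hz1 : z₀.1 = 0 := by rw [hz₀def]
  have hz2 : z₀.2 = y' := by rw [hz₀def]
  have hz₀sub : ∀ ρ : ℝ, parabolicCylinder ρ z₀ ⊆ Iio (0 : ℝ) ×ˢ (univ : Set (EuclideanSpace ℝ (Fin 3))) := fun ρ =>
    parabolicCylinder_subset_lowerHalf ρ y'
  have hQsl : ∀ ρ : ℝ, (parabolicCylinderOpens ρ z₀ : TopologicalSpace.Opens (ℝ × (EuclideanSpace ℝ (Fin 3)))) ≤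
      slab (EuclideanSpace ℝ (Fin 3)) (Iio 0) isOpen_Iio := fun ρ w hw => hz₀sub ρ hw
  -- ## the zoomed triples
  set v : ℕ → ℝ → (EuclideanSpace ℝ (Fin 3)) → (EuclideanSpace ℝ (Fin 3)) := fun k => L k • stPull (L k ^ 2) (L k) z₀.1 z₀.2 U with hvdef
  set q : ℕ → ℝ → (EuclideanSpace ℝ (Fin 3)) → ℝ := fun k => L k ^ 2 • stPull (L k ^ 2) (L k) z₀.1 z₀.2 P with hqdef
  set Gz : ℕ → ℝ → (EuclideanSpace ℝ (Fin 3)) → (EuclideanSpace ℝ (Fin 3)) →L[ℝ] (EuclideanSpace ℝ (Fin 3)) :=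
    fun k => L k ^ 2 • stPull (L k ^ 2) (L k) z₀.1 z₀.2 H with hGzdef
  -- the class on every `Q(0, 2ᵐ)`
  have hballs : ∀ m k : ℕ, IsSuitableWeakSolutionInBall ((2 : ℝ) ^ m) 0 (v k) (q k) := by
    intro m k
    set ρ : ℝ := (2 : ℝ) ^ m * L k with hρ
    have hρ0 : 0 < ρ := mul_pos (hcc_pos m) (hL k)
    have hsub : parabolicCylinder ρ z₀ ⊆ parabolicCylinder (‖y'‖ + ρ) (0 : ℝ × (EuclideanSpace ℝ (Fin 3))) :=
      parabolicCylinder_subset_zero (pow_le_pow_left₀ hρ0.le (by linarith [norm_nonneg y']) 2)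
        le_rfl
    have h0 : IsSuitableWeakSolutionInBall ρ z₀ U P :=
      (hIB (‖y'‖ + ρ) (by positivity)).of_subset_zero (z := z₀) hρ0 hsub
    have h1 := h0.zoom hρ0
    set c : ℝ := L k / ρ with hc
    have hc0 : 0 < c := div_pos (hL k) hρ0
    have h2 := h1.zoomOut hc0
    have hcρ : c * ρ = L k := div_mul_cancel₀ _ hρ0.ne'
    have hrad : 1 / c = (2 : ℝ) ^ m := by
      rw [hc, one_div_div, hρ, mul_div_cancel_right₀ _ (hL k).ne']
    rw [zoom_zoom, zoom_zoom, hcρ, hrad, show c ^ 2 * ρ ^ 2 = L k ^ 2 by rw [← hcρ]; ring] at h2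
    exact h2
  -- the weak gradients
  have hgrads : ∀ m k : ℕ,
      HasWeakSpatialGradientOn (parabolicCylinderOpens ((2 : ℝ) ^ m) (0 : ℝ × (EuclideanSpace ℝ (Fin 3)))) (v k) (Gz k) := by
    intro m k
    set ρ : ℝ := (2 : ℝ) ^ m * L k with hρ
    have hρL : ρ / L k = (2 : ℝ) ^ m := by rw [hρ, mul_div_cancel_right₀ _ (hL k).ne']
    have h1 := (hH.mono (hQsl ρ)).stRescale (L k) (β := L k ^ 2) (γ := L k) (pow_pos (hL k) 2)
      (hL k) z₀.1 z₀.2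
    have hpre : stPreimage (L k ^ 2) (L k) z₀.1 z₀.2 (parabolicCylinderOpens ρ z₀) =
        parabolicCylinderOpens ((2 : ℝ) ^ m) (0 : ℝ × (EuclideanSpace ℝ (Fin 3))) := by
      refine TopologicalSpace.Opens.ext ?_
      have e := zoom_preimage_parabolicCylinder (hL k) z₀ ρ
      rw [hρL] at e
      exact e
    rw [show L k * L k = L k ^ 2 by ring, hpre] at h1
    exact h1
  -- the Type I bound
  have hIs : ∀ m k : ℕ,
      typeIBound (parabolicCylinder ((2 : ℝ) ^ m) (0 : ℝ × (EuclideanSpace ℝ (Fin 3)))) (v k) (q k) (Gz k) ≤ I₀ := by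
    intro m k
    set ρ : ℝ := (2 : ℝ) ^ m * L k with hρ
    have hρL : ρ / L k = (2 : ℝ) ^ m := by rw [hρ, mul_div_cancel_right₀ _ (hL k).ne']
    refine le_trans ?_ (typeIBound_mono (hz₀sub ρ))
    rw [← typeIBound_nsZoom (hL k) z₀.1 z₀.2 (parabolicCylinder ρ z₀) U P H,
      zoom_preimage_parabolicCylinder (hL k) z₀ ρ, hρL]
  -- ## compactness with the class on all balls (tree)
  obtain ⟨Ut, Pt, Ht, σ, hσ, hIBU, hswU, hHU, h4I, hmemU, hconvU, -⟩ :=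
    Summit.NavierStokesRegularity.NavierStokesRegularity.Cruxes.ScarEnvelopeTypeI.SliceBudget.local_typeI_compactness_twin_inBall
      I₀ v q Gz hI (fun m k _ => hballs m k) (fun m k _ => hgrads m k) (fun m k _ => hIs m k)
  have h4Itop : typeIBound (Iio (0 : ℝ) ×ˢ univ) Ut Pt Ht < ⊤ :=
    lt_of_le_of_lt h4I (ENNReal.mul_lt_top (by simp) hI)
  -- ## the rate: on the zooms everywhere, on the limit a.e.
  have hratev : ∀ (k : ℕ) (s : ℝ) (y : (EuclideanSpace ℝ (Fin 3))), s < 0 → ‖v k s y‖ ≤ M / Real.sqrt (-s) := by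
    intro k s y hs
    have hL2 : 0 < L k ^ 2 := pow_pos (hL k) 2
    have hL2s : L k ^ 2 * s < 0 := mul_neg_of_pos_of_neg hL2 hs
    have h := hdec _ hL2s (y' + L k • y)
    have hsq : Real.sqrt (-(L k ^ 2 * s)) = L k * Real.sqrt (-s) := by
      rw [show -(L k ^ 2 * s) = L k ^ 2 * (-s) by ring, Real.sqrt_mul (sq_nonneg _),
        Real.sqrt_sq (hL k).le]
    rw [hsq] at h
    have hspos : 0 < Real.sqrt (-s) := Real.sqrt_pos.2 (by linarith)
    show ‖(L k • stPull (L k ^ 2) (L k) z₀.1 z₀.2 U) s y‖ ≤ M / Real.sqrt (-s)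
    rw [smul_stPull_apply, hz1, hz2, zero_add, norm_smul, Real.norm_of_nonneg (hL k).le,
      le_div_iff₀ hspos]
    have h' := (le_div_iff₀ (mul_pos (hL k) hspos)).1 h
    calc L k * ‖U (L k ^ 2 * s) (y' + L k • y)‖ * Real.sqrt (-s)
        = ‖U (L k ^ 2 * s) (y' + L k • y)‖ * (L k * Real.sqrt (-s)) := by ring
      _ ≤ M := h'
  have hrate_ae : ∀ᵐ w ∂(volume.restrict (Iio (0 : ℝ) ×ˢ (univ : Set (EuclideanSpace ℝ (Fin 3))))),
      ‖Ut w.1 w.2‖ ≤ M / Real.sqrt (-w.1) := by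
    have hQ : ∀ m : ℕ, ∀ᵐ w ∂(volume.restrict (parabolicCylinder ((2 : ℝ) ^ m) (0 : ℝ × (EuclideanSpace ℝ (Fin 3))))),
        ‖Ut w.1 w.2‖ ≤ M / Real.sqrt (-w.1) := by
      intro m
      have hmeas : ∀ j, AEStronglyMeasurable (Function.uncurry (v (σ j)))
          (volume.restrict (parabolicCylinder ((2 : ℝ) ^ m) (0 : ℝ × (EuclideanSpace ℝ (Fin 3))))) := fun j =>
        (hballs m (σ j)).1.distributional.1.aestronglyMeasurable
      obtain ⟨ψ, -, hae⟩ := exists_subseq_tendsto_ae₃ hmeas (hmemU _ (hcc_pos m)).1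
        (hconvU _ (hcc_pos m))
      filter_upwards [hae, ae_restrict_mem (isOpen_parabolicCylinder _ _).measurableSet]
        with w hw hwmem
      refine le_of_tendsto hw.norm (Eventually.of_forall fun i => ?_)
      have hw0 : w.1 < 0 := by
        have h1 := ((mem_parabolicCylinder).1 hwmem).1.2
        simpa using h1
      exact hratev _ w.1 w.2 hw0
    have hcover : (Iio (0 : ℝ) ×ˢ (univ : Set (EuclideanSpace ℝ (Fin 3)))) ⊆
        ⋃ m : ℕ, parabolicCylinder ((2 : ℝ) ^ m) (0 : ℝ × (EuclideanSpace ℝ (Fin 3))) := by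
      rintro ⟨t, x⟩ ⟨ht', -⟩
      obtain ⟨m, hm⟩ := exists_mem_parabolicCylinder_two_pow₃ (mem_Iio.1 ht') x
      exact mem_iUnion.2 ⟨m, hm⟩
    exact ae_restrict_of_ae_restrict_of_subset hcover ((ae_restrict_iUnion_iff _ _).2 hQ)
  -- ## representatives: the rate everywhere, then continuous Oseen-mild (KNSS)
  obtain ⟨U₁, hae₁, hdec₁⟩ := exists_repr_hasTypeITimeDecay hM hrate_ae
  have hae₁' : ∀ᵐ w ∂(volume.restrict ((slab (EuclideanSpace ℝ (Fin 3)) (Iio 0) isOpen_Iio :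
      TopologicalSpace.Opens (ℝ × (EuclideanSpace ℝ (Fin 3)))) : Set (ℝ × (EuclideanSpace ℝ (Fin 3))))), Function.uncurry Ut w = Function.uncurry U₁ w := by
    rw [coe_slab]
    exact hae₁
  have hsw₁ : IsSuitableWeakSolutionOn (slab (EuclideanSpace ℝ (Fin 3)) (Iio 0) isOpen_Iio) 1 0 U₁ Pt :=
    hswU.congr_ae hae₁' (ae_of_all _ fun _ => rfl)
  have hI₁ : typeIBound (Iio (0 : ℝ) ×ˢ univ) U₁ Pt Ht < ⊤ := by
    rwa [← typeIBound_congr_ae hae₁]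
  obtain ⟨U', hae₂, hUc, hUdiv, hUmild, hUrate⟩ :=
    exists_oseenMild_repr_of_typeIBound_lt_top hsw₁ hdec₁ hI₁
  have hae : ∀ᵐ w ∂(volume.restrict (Iio (0 : ℝ) ×ˢ (univ : Set (EuclideanSpace ℝ (Fin 3))))),
      Function.uncurry Ut w = Function.uncurry U' w := by
    filter_upwards [hae₁, hae₂] with w h1 h2
    rw [h1, h2]
  have hae' : ∀ᵐ w ∂(volume.restrict ((slab (EuclideanSpace ℝ (Fin 3)) (Iio 0) isOpen_Iio :
      TopologicalSpace.Opens (ℝ × (EuclideanSpace ℝ (Fin 3)))) : Set (ℝ × (EuclideanSpace ℝ (Fin 3))))), Function.uncurry Ut w = Function.uncurry U' w := by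
    rw [coe_slab]
    exact hae
  have hTI : IsTypeIAncientMild M U' :=
    LocalTypeIBlowup.isTypeIAncientMild_of_continuous_oseenMild_rate hUc hUdiv hUmild hUrate
  have hIBU' : ∀ a : ℝ, 0 < a → IsSuitableWeakSolutionInBall a (0 : ℝ × (EuclideanSpace ℝ (Fin 3))) U' Pt := fun a ha =>
    (hIBU a ha).congr_ae'
      (ae_restrict_of_ae_restrict_of_subset (parabolicCylinder_origin_subset_slab a) hae)
      (ae_of_all _ fun _ => rfl)
  have hHU' : HasWeakSpatialGradientOn (slab (EuclideanSpace ℝ (Fin 3)) (Iio 0) isOpen_Iio) U' Ht := hHU.congr_ae hae'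
  have hIU' : typeIBound (Iio (0 : ℝ) ×ˢ univ) U' Pt Ht < ⊤ := by
    rw [← typeIBound_congr_ae hae]
    exact h4Itop
  refine ⟨U', Pt, Ht, ⟨hTI, hIBU', hHU', hIU'⟩, fun R hR => ?_⟩
  -- ## identification with the tangent flow on `Q_R(0)`, `R < 1`
  obtain ⟨hR0, hR1⟩ := hR
  obtain ⟨-, hŪmem, hconvŪ, -⟩ := hTR R ⟨hR0, hR1⟩
  have hsubR : parabolicCylinder R (0 : ℝ × (EuclideanSpace ℝ (Fin 3))) ⊆ parabolicCylinder ((2 : ℝ) ^ 0) (0 : ℝ × (EuclideanSpace ℝ (Fin 3))) :=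
    parabolicCylinder_mono hR0.le (by rw [pow_zero]; exact hR1.le) _
  have hμR : volume.restrict (parabolicCylinder R (0 : ℝ × (EuclideanSpace ℝ (Fin 3)))) ≤
      volume.restrict (parabolicCylinder ((2 : ℝ) ^ 0) (0 : ℝ × (EuclideanSpace ℝ (Fin 3)))) :=
    Measure.restrict_mono hsubR le_rfl
  have hmeasv : ∀ j, AEStronglyMeasurable (Function.uncurry (v (σ j)))
      (volume.restrict (parabolicCylinder R (0 : ℝ × (EuclideanSpace ℝ (Fin 3))))) := fun j =>
    ((hballs 0 (σ j)).1.distributional.1.aestronglyMeasurable).mono_measure hμR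
  have h1 : Tendsto (fun j => eLpNorm (Function.uncurry (v (σ j)) - Function.uncurry Ū) 3
      (volume.restrict (parabolicCylinder R (0 : ℝ × (EuclideanSpace ℝ (Fin 3)))))) atTop (𝓝 0) :=
    hconvŪ.comp hσ.tendsto_atTop
  have hae3 : Function.uncurry Ū =ᵐ[volume.restrict (parabolicCylinder R (0 : ℝ × (EuclideanSpace ℝ (Fin 3))))] Function.uncurry Ut :=
    ae_eq_of_tendsto_eLpNorm_three hmeasv hŪmem.1 (hmemU R hR0).1 h1 (hconvU R hR0)
  have hae4 : ∀ᵐ w ∂(volume.restrict (parabolicCylinder R (0 : ℝ × (EuclideanSpace ℝ (Fin 3))))),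
      Function.uncurry Ut w = Function.uncurry U' w :=
    ae_restrict_of_ae_restrict_of_subset (parabolicCylinder_origin_subset_slab R) hae
  filter_upwards [hae3, hae4] with w h3 h4
  exact h3.trans h4

end Tower

end Summit.NavierStokesRegularity.NavierStokesRegularity.Cruxes.ScarEnvelopeTypeI.ZoomDictionary
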